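import Summits.QuantumFields.YangMills.Theorems.SwapVirialDeficitSwapRingFloor
import Summits.QuantumFields.YangMills.Theorems.SwapVirialDeficitSwapRingLeaderVolume
import Summits.QuantumFields.YangMills.Theorems.SwapVirialDeficitNearlyCommutingThreeFloor
import Summits.QuantumFields.YangMills.Theorems.SwapTwistDeficitPeriodicRingFloorLog
import HarnessLib

/-!
# The LOG-FREE floor of the σ-glued (swap-twisted) zero-flux trace at every fixed `L ≥ 1`, UNCONDITIONALLY:
# `c_L·u^{9L⁴−1} ≤ μ_L{F^S_0 ≤ u}` and `c_L·e^{12βL⁴}·β^{−(9L⁴−1)} ≤ TT.twistTrace L β (2L)`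
# (closing brick (α2-vii) of LEAD ym-line-sfw-p2 g93's fixed-`L` programme, 05:57Z/06:19Z rulings; free-hands support of item stmt-QuantumFields-24197
# `SwapVirialDeficit.SwapGluedStiffness`; composes seat w2 g54's three-letter floor (α1) ✓`NearlyCommutingThreeFloor.haar_pi_nearlyCommuting_three_ge`
# with this seat's σ-ring chain (α2-i…vi): ✓`swapCommVolume_of_threeLetterVolume` (slaved letter) and ✓`swap_twistTrace_floor_of_leaderVolume` (Laplace floor))

* §1 `nearlyCommuting_three_subset`, `threeLetterVolume_frobNorm` — the three-letter floor transported from the quaternion norm to the Frobenius norm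
  (`‖A − B‖_F = √2·‖q(A) − q(B)‖`): `c′/4 · t⁴ ≤ Haar³{∀ μ ν, ‖D_μD_ν − D_νD_μ‖_F ≤ t}` on `(0, √2·t₀′]`;
* §2 ★ `swapCommVolume` — the σ-twisted four-letter leader volume `c·s⁷ ≤ Haar⁴{(C₀,C₁,C₂) pairwise ‖·‖_F-commuting up to s ∧ ‖c·C_{σμ} − C_μ·c‖_F ≤ s}`
  on `(0, s₀]`, `s₀ ≤ 1` (three letters `s⁴` × slaved letter `s³`);
* §3 ★★ `swap_volume_floor` — `c_L·u^{9L⁴−1} ≤ (ringMeasure L).real {F^S_0 ≤ u}` on `(0, u₀]`;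
  ★★★ `swap_twistTrace_floor` (and `swap_twistTrace_floor_rpow`) — `c_L·e^{12βL⁴}·(β^{9L⁴−1})⁻¹ ≤ TT.twistTrace L β (2L)` for `β ≥ β₀`: exponent
  `9L⁴ − 1 = (18L⁴ − 2)/2` (swap-central cone of commuting TRIPLES plus one slaved letter, pole `2`, multiplicity `1`) and NO logarithm, against the periodic
  `9L⁴ − 3/2` WITH `log β` of ✓`PeriodicRingFloor.log_physTrace_floor` — the fixed-`L` prediction row `⟨S⟩ = Z^S/Z ≍ β^{−1/2}/log β → 0` of seat w2 g54's
  census SWAP-STRATA now has BOTH floors as theorems; `swap_twistTrace_floor_rpow` is literally the hypothesis `hfloor` of w2 g54's parametric ratio floor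
  ✓`TwistRatioFloor.twistRatio_floor_of_bounds` (the two CEILINGS are LEAD g93's σ-twisted leader ceiling / fcl-p3 g43's periodic ceiling, in flight).

HONEST FRAMING: the cheap direction (floors) of fixed-`L` Laplace asymptotics, with `exp(−O(L⁴ log L))`-class constants; the CEILINGS (the stiffness direction that
⟨24197⟩/⟨24194⟩ consume, and the ratio statement) are NOT proved here; no crux, rung or summit is proved; the Yang–Mills mass gap is NOT proved; no summit is
proved by a line.  THEOREMS ONLY (0 `def`, 0 `sorry`), standard axioms.  Width seat ym-line-sfw-p2-w3 g61 (cell ym-idea-1, free hands),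
`--supports stmt-QuantumFields-24197`.  References: [cite: tHooft1979]; [cite: Luscher1983, §2]; [cite: GonzalezarroyoAltes1988]; [cite: Vanbaal2001].
-/

set_option autoImplicit false

noncomputable section

open MeasureTheory
open scoped BigOperators ENNReal Quaternion
open Literature.MathematicalPhysics.QuantumFieldTheory hiding SU2 su2Quat_mul
open Literature.MathematicalPhysics.QuantumLattice

namespace Summit.QuantumFields.YangMills.Theorems.SwapVirialDeficit.SwapRing

open Summit.QuantumFields.YangMills.Theorems.FemtoTransferGap
open Summit.QuantumFields.YangMills.Theorems.FemtoTransferGap.TT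
open Summit.QuantumFields.YangMills.Theorems.VirialFluxGap.RingDeficit
open Summit.QuantumFields.YangMills.Theorems.SwapTwistDeficit.PeriodicRingFloor
open Summit.QuantumFields.YangMills.Theorems.SwapVirialDeficit.NearlyCommutingThreeFloor (haar_pi_nearlyCommuting_three_ge)

/-! ## §1 The three-letter floor in Frobenius norm -/

/-- Quaternion-nearly-commuting TRIPLES are Frobenius-nearly-commuting with radius `√2·t` (`‖A − B‖_F = √2·‖q(A) − q(B)‖` on `SU(2)`,
✓`PeriodicRingFloor.frobNorm_comm_eq_sqrt_two_mul`; the three-letter analogue of ✓`PeriodicRingFloor.nearlyCommuting_subset`). [folklore] -/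
theorem nearlyCommuting_three_subset (t : ℝ) :
    {D : Fin 3 → SU2 | ∀ μ ν : Fin 3, ‖su2Quat (D μ) * su2Quat (D ν) - su2Quat (D ν) * su2Quat (D μ)‖ ≤ t} ⊆
      {D : Fin 3 → SU2 | ∀ μ ν : Fin 3,
        frobNorm (((D μ * D ν : SU2) : Matrix (Fin 2) (Fin 2) ℂ) - ((D ν * D μ : SU2) : Matrix (Fin 2) (Fin 2) ℂ)) ≤ Real.sqrt 2 * t} := by
  intro D hD μ ν
  simp only [Set.mem_setOf_eq] at hD ⊢
  rw [frobNorm_comm_eq_sqrt_two_mul]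
  exact mul_le_mul_of_nonneg_left (hD μ ν) (Real.sqrt_nonneg _)

/-- **The three-letter floor in Frobenius form**: there are `c > 0`, `t₀ > 0` with `c·t⁴ ≤ Haar³{D : SU(2)³ | ∀ μ ν, ‖D_μD_ν − D_νD_μ‖_F ≤ t}` for
`0 < t ≤ t₀` — w2 g54's log-free three-letter floor ✓`NearlyCommutingThreeFloor.haar_pi_nearlyCommuting_three_ge` (quaternion norm, constant `c′`,
range `t₀′`) transported along `‖·‖_F = √2·‖q(·)‖`: `c = c′/4`, `t₀ = √2·t₀′`. [folklore] [cite: Luscher1983, §2] -/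
theorem threeLetterVolume_frobNorm :
    ∃ c : ℝ, 0 < c ∧ ∃ t₀ : ℝ, 0 < t₀ ∧ ∀ t : ℝ, 0 < t → t ≤ t₀ →
      c * t ^ 4 ≤ (Measure.pi fun _ : Fin 3 => haarProbability SU2).real
        {D : Fin 3 → SU2 | ∀ μ ν : Fin 3,
          frobNorm (((D μ * D ν : SU2) : Matrix (Fin 2) (Fin 2) ℂ) - ((D ν * D μ : SU2) : Matrix (Fin 2) (Fin 2) ℂ)) ≤ t} := by
  obtain ⟨c, hc, t₀, ht₀, hvol⟩ := haar_pi_nearlyCommuting_three_ge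
  haveI : IsProbabilityMeasure (Measure.pi fun _ : Fin 3 => haarProbability SU2) := inferInstance
  have h2 : (0 : ℝ) < Real.sqrt 2 := Real.sqrt_pos.2 (by norm_num)
  have hsq : Real.sqrt 2 ^ 2 = 2 := Real.sq_sqrt (by norm_num)
  refine ⟨c / 4, by positivity, Real.sqrt 2 * t₀, by positivity, fun t ht htt => ?_⟩
  -- the quaternion event at radius `t/√2` sits inside the Frobenius event at radius `t`
  have ht' : 0 < t / Real.sqrt 2 := div_pos ht h2
  have htt' : t / Real.sqrt 2 ≤ t₀ := by rw [div_le_iff₀ h2]; linarith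
  have hv := hvol (t / Real.sqrt 2) ht' htt'
  have hsub := nearlyCommuting_three_subset (t / Real.sqrt 2)
  rw [mul_div_cancel₀ _ h2.ne'] at hsub
  have hmono := measureReal_mono (μ := Measure.pi fun _ : Fin 3 => haarProbability SU2) hsub (measure_ne_top _ _)
  have h4 : (t / Real.sqrt 2) ^ 4 = t ^ 4 / 4 := by
    rw [div_pow]
    have : Real.sqrt 2 ^ 4 = (Real.sqrt 2 ^ 2) ^ 2 := by ring
    rw [this, hsq]; norm_num
  calc c / 4 * t ^ 4 = c * (t / Real.sqrt 2) ^ 4 := by rw [h4]; ring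
    _ ≤ _ := hv
    _ ≤ _ := hmono

/-! ## §2 The σ-twisted leader volume -/

/-- ★ **THE σ-TWISTED FOUR-LETTER LEADER VOLUME, unconditionally**: there are `c > 0` and `s₀ ∈ (0, 1]` such that for `0 < s ≤ s₀` the product-Haar
mass of the quadruples `C ∈ SU(2)⁴` whose first three letters pairwise commute up to `s` in Frobenius norm and whose last letter `c = C 3`
intertwines the swap, `‖c·C_{σμ} − C_μ·c‖_F ≤ s` (`σ = (0 1)`), is at least `c·s⁷` — w2 g54's three-letter floor `≍ t⁴` (no logarithm) times the
`s³`-ball of the slaved letter, via ✓`swapCommVolume_of_threeLetterVolume`. [folklore] [cite: tHooft1979] [cite: GonzalezarroyoAltes1988] -/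
theorem swapCommVolume :
    ∃ c : ℝ, 0 < c ∧ ∃ s₀ : ℝ, 0 < s₀ ∧ s₀ ≤ 1 ∧ ∀ s : ℝ, 0 < s → s ≤ s₀ →
      c * s ^ 7 ≤ (Measure.pi fun _ : Fin 4 => haarProbability SU2).real {C : Fin 4 → SU2 |
        (∀ μ ν : Fin 3, frobNorm (((C (Fin.castSucc μ) * C (Fin.castSucc ν) : SU2) : Matrix (Fin 2) (Fin 2) ℂ) -
          ((C (Fin.castSucc ν) * C (Fin.castSucc μ) : SU2) : Matrix (Fin 2) (Fin 2) ℂ)) ≤ s) ∧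
        ∀ μ : Fin 3, frobNorm (((C (Fin.last 3) * C (Fin.castSucc (Equiv.swap (0 : Fin 3) 1 μ)) : SU2) : Matrix (Fin 2) (Fin 2) ℂ) -
          ((C (Fin.castSucc μ) * C (Fin.last 3) : SU2) : Matrix (Fin 2) (Fin 2) ℂ)) ≤ s} := by
  obtain ⟨c, hc, t₀, ht₀, hvol3⟩ := threeLetterVolume_frobNorm
  refine ⟨c / 34 / 5 ^ 7, by positivity, min (5 * t₀) 1, lt_min (by positivity) one_pos, min_le_right _ _, fun s hs hss => ?_⟩
  exact swapCommVolume_of_threeLetterVolume hc.le hvol3 hs (hss.trans (min_le_left _ _)) ((hss.trans (min_le_right _ _)).trans (by norm_num))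


/-! ## §3 The unconditional floors of the σ-glued ring -/
/-- ★★ **LOG-FREE VOLUME FLOOR OF THE σ-GLUED RING AT EVERY FIXED `L ≥ 1`, unconditionally**: there are `c_L > 0` and `u₀ > 0` with
`c_L · u^{9L⁴−1} ≤ μ_L{F^S_0 ≤ u}` for `0 < u ≤ u₀` — exponent `9L⁴ − 1 = (18L⁴ − 2)/2`, the codimension count of the swap-central cone
(three commuting letters + one slaved letter), and NO logarithm. [cite: tHooft1979] [cite: Luscher1983, §2] [cite: GonzalezarroyoAltes1988] -/
theorem swap_volume_floor (L : ℕ) [NeZero L] :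
    ∃ c : ℝ, 0 < c ∧ ∃ u₀ : ℝ, 0 < u₀ ∧ ∀ u : ℝ, 0 < u → u ≤ u₀ →
      c * u ^ (9 * L ^ 4 - 1) ≤ (ringMeasure L).real {P | swapRingDeficit L (fun _ => false) P ≤ u} := by
  obtain ⟨c, hc, s₀, hs₀, hs₀1, hvol⟩ := swapCommVolume
  have hL : (0 : ℝ) < L := by exact_mod_cast NeZero.pos L
  have hK : (0 : ℝ) < 1200 * (L : ℝ) ^ 4 := by positivity
  refine ⟨c * (1 / 34 : ℝ) ^ (6 * L ^ 4 - 3) * ((1200 * (L : ℝ) ^ 4) ^ (9 * L ^ 4 - 1))⁻¹, by positivity,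
    1200 * (L : ℝ) ^ 4 * s₀ ^ 2, by positivity, fun u hu0 hu => ?_⟩
  have h := swap_volume_floor_of_leaderVolume (L := L) hs₀ hs₀1 hvol hu0 hu
  rw [div_pow u] at h
  calc c * (1 / 34 : ℝ) ^ (6 * L ^ 4 - 3) * ((1200 * (L : ℝ) ^ 4) ^ (9 * L ^ 4 - 1))⁻¹ * u ^ (9 * L ^ 4 - 1)
      = c * (1 / 34 : ℝ) ^ (6 * L ^ 4 - 3) * (u ^ (9 * L ^ 4 - 1) / (1200 * (L : ℝ) ^ 4) ^ (9 * L ^ 4 - 1)) := by ring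
    _ ≤ _ := h

/-- ★★★ **LOG-FREE FLOOR OF THE SWAP-TWISTED THERMAL TRACE AT EVERY FIXED `L ≥ 1`, unconditionally**: there are `c_L > 0` and `β₀` with
`c_L · e^{12βL⁴} · β^{−(9L⁴−1)} ≤ TT.twistTrace L β (2L)` for `β ≥ β₀` — the swap side of the fixed-`L` prediction row
`Z^S ≍ e^{12βL⁴}β^{−(9L⁴−1)}` (NO logarithm) against the periodic side `Z ≍ e^{12βL⁴}β^{−(9L⁴−3/2)}·log β` (✓`PeriodicRingFloor.log_physTrace_floor`),
as a one-sided theorem (the ceiling of the same order is NOT proved here).  Composition of w2 g54's three-letter floor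
✓`NearlyCommutingThreeFloor.haar_pi_nearlyCommuting_three_ge`, the slaved-letter adapter ✓`swapCommVolume_of_threeLetterVolume`, and the σ-ring
Laplace floor ✓`swap_twistTrace_floor_of_leaderVolume`. [cite: tHooft1979] [cite: Luscher1983, §2] [cite: Vanbaal2001] [cite: GonzalezarroyoAltes1988] -/
theorem swap_twistTrace_floor (L : ℕ) [NeZero L] :
    ∃ c : ℝ, 0 < c ∧ ∃ β₀ : ℝ, ∀ β : ℝ, β₀ ≤ β →
      c * Real.exp (12 * β * (L : ℝ) ^ 4) * (β ^ (9 * L ^ 4 - 1))⁻¹ ≤ TT.twistTrace L β (2 * L) := by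
  obtain ⟨c, hc, s₀, hs₀, hs₀1, hvol⟩ := swapCommVolume
  have hL : (0 : ℝ) < L := by exact_mod_cast NeZero.pos L
  have hK : (0 : ℝ) < 1200 * (L : ℝ) ^ 4 := by positivity
  refine ⟨(1 / 8 : ℝ) * (Real.exp (-1) * (c * (1 / 34 : ℝ) ^ (6 * L ^ 4 - 3) * ((1200 * (L : ℝ) ^ 4) ^ (9 * L ^ 4 - 1))⁻¹)),
    by positivity, max 1 (1200 * (L : ℝ) ^ 4 * s₀ ^ 2)⁻¹, fun β hβ => ?_⟩
  have hβ1 : 1 ≤ β := (le_max_left _ _).trans hβ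
  have h := swap_twistTrace_floor_of_leaderVolume (L := L) hs₀ hs₀1 hvol hβ1 ((le_max_right _ _).trans hβ)
  rw [mul_pow (1200 * (L : ℝ) ^ 4) β, mul_inv] at h
  calc (1 / 8 : ℝ) * (Real.exp (-1) * (c * (1 / 34 : ℝ) ^ (6 * L ^ 4 - 3) * ((1200 * (L : ℝ) ^ 4) ^ (9 * L ^ 4 - 1))⁻¹)) *
        Real.exp (12 * β * (L : ℝ) ^ 4) * (β ^ (9 * L ^ 4 - 1))⁻¹
      = (1 / 8 : ℝ) * (Real.exp (12 * β * (L : ℝ) ^ 4) * (Real.exp (-1) * (c * (1 / 34 : ℝ) ^ (6 * L ^ 4 - 3) *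
          (((1200 * (L : ℝ) ^ 4) ^ (9 * L ^ 4 - 1))⁻¹ * (β ^ (9 * L ^ 4 - 1))⁻¹)))) := by ring
    _ ≤ _ := h

/-- The same floor with a real exponent, `c_L · e^{12βL⁴} · β^{−(9L⁴−1)} ≤ TT.twistTrace L β (2L)` (`Real.rpow`, the shape of
✓`PeriodicRingFloor.log_physTrace_floor`). [cite: tHooft1979] [cite: Luscher1983, §2] -/
theorem swap_twistTrace_floor_rpow (L : ℕ) [NeZero L] :
    ∃ c : ℝ, 0 < c ∧ ∃ β₀ : ℝ, ∀ β : ℝ, β₀ ≤ β →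
      c * Real.exp (12 * β * (L : ℝ) ^ 4) * β ^ (-(9 * (L : ℝ) ^ 4 - 1)) ≤ TT.twistTrace L β (2 * L) := by
  obtain ⟨c, hc, β₀, h⟩ := swap_twistTrace_floor L
  refine ⟨c, hc, max β₀ 1, fun β hβ => ?_⟩
  have hβ0 : 0 < β := lt_of_lt_of_le one_pos ((le_max_right _ _).trans hβ)
  have hL1 : 1 ≤ L := NeZero.one_le
  have h1 : 1 ≤ 9 * L ^ 4 := by have := Nat.one_le_pow 4 L hL1; omega
  have hcast : (-(9 * (L : ℝ) ^ 4 - 1)) = -(((9 * L ^ 4 - 1 : ℕ) : ℝ)) := by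
    rw [Nat.cast_sub h1]; push_cast; ring
  have hpow : β ^ (-(9 * (L : ℝ) ^ 4 - 1)) = (β ^ (9 * L ^ 4 - 1))⁻¹ := by
    rw [hcast, Real.rpow_neg hβ0.le, Real.rpow_natCast]
  rw [hpow]
  exact h β ((le_max_left _ _).trans hβ)

end Summit.QuantumFields.YangMills.Theorems.SwapVirialDeficit.SwapRing

end
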